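import Mathlib
import Summits.Parity.GeneralizedHardyLittlewood.Theorems.LiouvilleMADCosetDecorrelationStubWelchBound
import Summits.Parity.GeneralizedHardyLittlewood.Theorems.LiouvilleMADCosetDecorrelationStubNormalForm

/-!
# Welch floor for the coset sums of the crux `CosetDecorrelation` (line `SketchIdeator3`)

Stub `stub_welchFloor` of line `SketchIdeator3` of crux stmt-Parity-13317
(`Summit.Parity.GeneralizedHardyLittlewood.Theses.LiouvilleMAD.CosetDecorrelation`,
card `farey-level-mean-coupling`): the tightness lemma `WelchFloor` of IdeatorMemo3 §F4.
Welch 1974, doi:10.1109/TIT.1974.1055219, for the name (Welch's inner-product bound);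
Mathlib + the two landed stub files `…StubWelchBound` (Frobenius / Welch inequality
`stub_welchBound`) and `…StubNormalForm` (class inner product `normalForm_coset_eq_classInner`).

**What is proved.**  For GENERAL real row weights `F n m`, rows `1 ≤ n ≤ 2M`, the dyadic block
`m ∈ (M, 2M]` and a modulus `j ∈ [⌊√M⌋+1, 2⌊√M⌋+2)`, write
`V_n = Σ_{a<j} (Σ_{m ∈ (M,2M], m ≡ a (mod j)} F n m)²` (class variance) and
`T_j(n,n') = Σ_{(m,m') ∈ (M,2M]², m ≡ m' (mod j)} F n m · F n' m'` (coset sum).  If every `V_n`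
lies in `[M/2, 2M]` and `M ≥ 4096`, then `|T_j(n,n')| ≥ M^{3/4}/4` for SOME `n ≠ n'`: the exponent
`3/4` of the crux cannot be lowered whenever the variances have the random-model size `≍ M`.

**Proof sketch.**
* `welchFloor_gram_count` (abstract bookkeeping): if `(Σ_n V_n)² ≤ t · Σ_{n,n'} T(n,n')²`,
  `T(n,n) = V_n ∈ [L, U]` (`L ≥ 0`) and `|T(n,n')| ≤ B` off the diagonal, then
  `(N L)² ≤ t · (N U² + N² B²)` with `N = #𝒩` (split each row sum into its diagonal term and the
  `≤ N` off-diagonal terms).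
* `welchFloor_arith`: for `s ≥ 64` and `t ≤ 2s + 2`, `t · (8 s⁶ + s⁷/4) < s⁸`
  (`(2s+2)(8s⁶ + s⁷/4) = s⁸ − (s⁶/2)(s² − 33 s − 32)`).
* `stub_welchFloor`: by contradiction; feed `stub_welchBound` (with `𝒩 = Icc 1 (2M)`, `N = 2M`),
  the diagonal identity `T(n,n) = V_n` (`normalForm_coset_eq_classInner` with `f = g = F n`),
  `L = M/2`, `U = 2M`, `B = M^{3/4}/4`, `t = j ≤ 2√M + 2` into the count; with `s = √M` this reads
  `s⁸ ≤ j · (8 s⁶ + s⁷/4)`, contradicting `welchFloor_arith`.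
-/

namespace Summit.Parity.GeneralizedHardyLittlewood.Theorems.CosetDecorrelation.FareyLevelMeanCoupling

open Finset

/-- Abstract Welch-floor bookkeeping: if `(Σ_{n∈𝒩} V n)² ≤ t · Σ_{n,n'∈𝒩} (T n n')²`, the
diagonal is `T n n = V n ∈ [L, U]` with `L ≥ 0`, and every off-diagonal entry has `|T n n'| ≤ B`,
then `(#𝒩 · L)² ≤ t · (#𝒩 · U² + #𝒩 · #𝒩 · B²)`. [folklore] -/
theorem welchFloor_gram_count (𝒩 : Finset ℕ) (V : ℕ → ℝ) (T : ℕ → ℕ → ℝ) {t L U B : ℝ}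
    (ht : 0 ≤ t) (hL : 0 ≤ L)
    (hW : (∑ n ∈ 𝒩, V n) ^ 2 ≤ t * ∑ n ∈ 𝒩, ∑ n' ∈ 𝒩, T n n' ^ 2)
    (hdiag : ∀ n ∈ 𝒩, T n n = V n)
    (hlo : ∀ n ∈ 𝒩, L ≤ V n) (hhi : ∀ n ∈ 𝒩, V n ≤ U)
    (hoff : ∀ n ∈ 𝒩, ∀ n' ∈ 𝒩, n ≠ n' → |T n n'| ≤ B) :
    ((𝒩.card : ℝ) * L) ^ 2 ≤ t * ((𝒩.card : ℝ) * U ^ 2 + (𝒩.card : ℝ) * (𝒩.card : ℝ) * B ^ 2) := by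
  -- lower bound for the trace
  have h1 : (𝒩.card : ℝ) * L ≤ ∑ n ∈ 𝒩, V n := by
    have h := Finset.card_nsmul_le_sum 𝒩 V L hlo
    simpa [nsmul_eq_mul] using h
  have h2 : ((𝒩.card : ℝ) * L) ^ 2 ≤ (∑ n ∈ 𝒩, V n) ^ 2 :=
    sq_le_sq' (by linarith [mul_nonneg (Nat.cast_nonneg 𝒩.card) hL]) h1
  -- upper bound for the Frobenius norm: diagonal + off-diagonal
  have hrow : ∀ n ∈ 𝒩, ∑ n' ∈ 𝒩, T n n' ^ 2 ≤ U ^ 2 + (𝒩.card : ℝ) * B ^ 2 := by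
    intro n hn
    have hd : T n n ^ 2 ≤ U ^ 2 := by
      rw [hdiag n hn]
      exact sq_le_sq' (by linarith [hlo n hn, hhi n hn]) (hhi n hn)
    have ho : ∑ n' ∈ 𝒩.erase n, T n n' ^ 2 ≤ (𝒩.card : ℝ) * B ^ 2 :=
      calc ∑ n' ∈ 𝒩.erase n, T n n' ^ 2 ≤ ∑ _n' ∈ 𝒩.erase n, B ^ 2 := by
            refine sum_le_sum fun n' hn' => ?_
            have hb := hoff n hn n' (mem_of_mem_erase hn') (ne_of_mem_erase hn').symm
            exact sq_le_sq' (abs_le.mp hb).1 (abs_le.mp hb).2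
        _ = ((𝒩.erase n).card : ℝ) * B ^ 2 := by rw [sum_const, nsmul_eq_mul]
        _ ≤ (𝒩.card : ℝ) * B ^ 2 := by
            have hc : ((𝒩.erase n).card : ℝ) ≤ 𝒩.card := by exact_mod_cast card_erase_le
            exact mul_le_mul_of_nonneg_right hc (sq_nonneg B)
    calc ∑ n' ∈ 𝒩, T n n' ^ 2 = T n n ^ 2 + ∑ n' ∈ 𝒩.erase n, T n n' ^ 2 :=
          (add_sum_erase 𝒩 (fun n' => T n n' ^ 2) hn).symm
      _ ≤ U ^ 2 + (𝒩.card : ℝ) * B ^ 2 := add_le_add hd ho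
  have h3 : ∑ n ∈ 𝒩, ∑ n' ∈ 𝒩, T n n' ^ 2 ≤
      (𝒩.card : ℝ) * U ^ 2 + (𝒩.card : ℝ) * (𝒩.card : ℝ) * B ^ 2 :=
    calc ∑ n ∈ 𝒩, ∑ n' ∈ 𝒩, T n n' ^ 2 ≤ ∑ _n ∈ 𝒩, (U ^ 2 + (𝒩.card : ℝ) * B ^ 2) :=
          sum_le_sum hrow
      _ = (𝒩.card : ℝ) * (U ^ 2 + (𝒩.card : ℝ) * B ^ 2) := by rw [sum_const, nsmul_eq_mul]
      _ = (𝒩.card : ℝ) * U ^ 2 + (𝒩.card : ℝ) * (𝒩.card : ℝ) * B ^ 2 := by ring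
  calc ((𝒩.card : ℝ) * L) ^ 2 ≤ (∑ n ∈ 𝒩, V n) ^ 2 := h2
    _ ≤ t * ∑ n ∈ 𝒩, ∑ n' ∈ 𝒩, T n n' ^ 2 := hW
    _ ≤ t * ((𝒩.card : ℝ) * U ^ 2 + (𝒩.card : ℝ) * (𝒩.card : ℝ) * B ^ 2) :=
        mul_le_mul_of_nonneg_left h3 ht

/-- The closing real inequality, in the variable `s = √M`: for `s ≥ 64` and `t ≤ 2s + 2`,
`t · (8 s⁶ + s⁷/4) < s⁸`, since `(2s+2)(8s⁶ + s⁷/4) = s⁸ − (s⁶/2)(s² − 33 s − 32)` and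
`s² − 33 s − 32 > 0` for `s ≥ 64`. [folklore] -/
theorem welchFloor_arith {s t : ℝ} (hs : 64 ≤ s) (ht : t ≤ 2 * s + 2) :
    t * (8 * s ^ 6 + s ^ 7 / 4) < s ^ 8 := by
  have hs0 : 0 < s := by linarith
  have h6 : 0 < s ^ 6 := pow_pos hs0 6
  have h7 : 0 < s ^ 7 := pow_pos hs0 7
  have hstuff : 0 ≤ 8 * s ^ 6 + s ^ 7 / 4 := by positivity
  have hq : 0 < s ^ 2 - 33 * s - 32 := by
    nlinarith [mul_nonneg (show (0 : ℝ) ≤ s - 64 by linarith) (show (0 : ℝ) ≤ s + 31 by linarith)]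
  have hprod : 0 < s ^ 6 / 2 * (s ^ 2 - 33 * s - 32) := mul_pos (by linarith) hq
  calc t * (8 * s ^ 6 + s ^ 7 / 4) ≤ (2 * s + 2) * (8 * s ^ 6 + s ^ 7 / 4) :=
        mul_le_mul_of_nonneg_right ht hstuff
    _ = s ^ 8 - s ^ 6 / 2 * (s ^ 2 - 33 * s - 32) := by ring
    _ < s ^ 8 := by linarith

/-- **STUB P6 · `stub_welchFloor`** (WELCH FLOOR, general real row weights): for `M ≥ 4096` and
`j ∈ [⌊√M⌋+1, 2⌊√M⌋+2)`, if every row variance `V_n = Σ_{a<j} (Σ_{m ∈ (M,2M], m ≡ a (j)} F n m)²`,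
`1 ≤ n ≤ 2M`, lies in `[M/2, 2M]`, then some off-diagonal coset sum has
`|Σ_{(m,m') ∈ (M,2M]², m ≡ m' (j)} F n m · F n' m'| ≥ M^{3/4}/4`, `n ≠ n'`.
Proof: `stub_welchBound` gives `Σ_{n,n'} T² ≥ (Σ_n V_n)²/j ≥ M⁴/(2√M+2)`; the diagonal
contributes `≤ 2M · (2M)² = 8M³` (`T(n,n) = V_n`, `normalForm_coset_eq_classInner`), and if all
`4M²` off-diagonal terms were `< M^{3/4}/4` they would contribute `< M^{7/2}/4`; with `s = √M ≥ 64`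
this is `s⁸ ≤ j (8 s⁶ + s⁷/4) ≤ (2s+2)(8 s⁶ + s⁷/4) < s⁸`, absurd.  Tightness of the crux's
exponent: `ϑ < 0` is impossible whenever `V_n ≍ M`. [folklore; Welch 1974,
doi:10.1109/TIT.1974.1055219] -/
theorem stub_welchFloor :
    ∃ M₀ : ℕ, ∀ (F : ℕ → ℕ → ℝ) (M j : ℕ), M₀ ≤ M → Nat.sqrt M + 1 ≤ j → j < 2 * (Nat.sqrt M + 1) →
      (∀ n ∈ Finset.Icc 1 (2 * M), (M : ℝ) / 2 ≤
          ∑ a ∈ Finset.range j, (∑ m ∈ (Finset.Ioc M (2 * M)).filter (fun m => m ≡ a [MOD j]), F n m) ^ 2) →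
      (∀ n ∈ Finset.Icc 1 (2 * M),
          ∑ a ∈ Finset.range j, (∑ m ∈ (Finset.Ioc M (2 * M)).filter (fun m => m ≡ a [MOD j]), F n m) ^ 2
            ≤ 2 * (M : ℝ)) →
      ∃ n ∈ Finset.Icc 1 (2 * M), ∃ n' ∈ Finset.Icc 1 (2 * M), n ≠ n' ∧
        (M : ℝ) ^ (3 / 4 : ℝ) / 4 ≤
          |∑ p ∈ (Finset.Ioc M (2 * M) ×ˢ Finset.Ioc M (2 * M)).filter
              (fun p : ℕ × ℕ => p.1 ≡ p.2 [MOD j]), F n p.1 * F n' p.2| := by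
  refine ⟨4096, fun F M j hM hj1 hj2 hlo hhi => ?_⟩
  by_contra h
  push Not at h
  have hj0 : 1 ≤ j := le_trans (Nat.le_add_left 1 _) hj1
  have hM0 : (0 : ℝ) ≤ (M : ℝ) := Nat.cast_nonneg M
  -- the diagonal identity `T(n,n) = V_n`
  have hdiag : ∀ n ∈ Finset.Icc 1 (2 * M),
      (∑ p ∈ (Finset.Ioc M (2 * M) ×ˢ Finset.Ioc M (2 * M)).filter
          (fun p : ℕ × ℕ => p.1 ≡ p.2 [MOD j]), F n p.1 * F n p.2) =
        ∑ a ∈ Finset.range j,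
          (∑ m ∈ (Finset.Ioc M (2 * M)).filter (fun m => m ≡ a [MOD j]), F n m) ^ 2 := by
    intro n _
    rw [normalForm_coset_eq_classInner (F n) (F n) M j hj0]
    exact sum_congr rfl fun a _ => (sq _).symm
  -- the abstract count with `𝒩 = Icc 1 (2M)`, `L = M/2`, `U = 2M`, `B = M^{3/4}/4`, `t = j`
  have hcount :
      (((Finset.Icc 1 (2 * M)).card : ℝ) * ((M : ℝ) / 2)) ^ 2 ≤
        (j : ℝ) * (((Finset.Icc 1 (2 * M)).card : ℝ) * (2 * (M : ℝ)) ^ 2 +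
          ((Finset.Icc 1 (2 * M)).card : ℝ) * ((Finset.Icc 1 (2 * M)).card : ℝ) *
            ((M : ℝ) ^ (3 / 4 : ℝ) / 4) ^ 2) :=
    welchFloor_gram_count (Finset.Icc 1 (2 * M))
      (fun n => ∑ a ∈ Finset.range j,
        (∑ m ∈ (Finset.Ioc M (2 * M)).filter (fun m => m ≡ a [MOD j]), F n m) ^ 2)
      (fun n n' => ∑ p ∈ (Finset.Ioc M (2 * M) ×ˢ Finset.Ioc M (2 * M)).filter
        (fun p : ℕ × ℕ => p.1 ≡ p.2 [MOD j]), F n p.1 * F n' p.2)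
      (Nat.cast_nonneg j) (by positivity) (stub_welchBound F M j _ hj0) hdiag hlo hhi
      (fun n hn n' hn' hne => (h n hn n' hn' hne).le)
  -- card (Icc 1 (2M)) = 2M
  have hcard : ((Finset.Icc 1 (2 * M)).card : ℝ) = 2 * (M : ℝ) := by
    rw [Nat.card_Icc, Nat.add_sub_cancel]
    push_cast
    ring
  rw [hcard] at hcount
  -- the working variable `s = √M`
  obtain ⟨s, hs_def⟩ : ∃ s : ℝ, s = Real.sqrt (M : ℝ) := ⟨_, rfl⟩
  have hx : (M : ℝ) = s ^ 2 := by rw [hs_def, Real.sq_sqrt hM0]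
  have hs64 : (64 : ℝ) ≤ s := by
    rw [hs_def]
    have h4096 : (64 : ℝ) ^ 2 ≤ (M : ℝ) := by
      have : ((4096 : ℕ) : ℝ) ≤ (M : ℝ) := by exact_mod_cast hM
      norm_num at this ⊢
      exact this
    calc (64 : ℝ) = Real.sqrt ((64 : ℝ) ^ 2) := (Real.sqrt_sq (by norm_num)).symm
      _ ≤ Real.sqrt (M : ℝ) := Real.sqrt_le_sqrt h4096
  have hjs : (j : ℝ) ≤ 2 * s + 2 := by
    have h1 : (j : ℝ) < 2 * (((Nat.sqrt M : ℕ) : ℝ) + 1) := by exact_mod_cast hj2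
    have h2 : ((Nat.sqrt M : ℕ) : ℝ) ≤ s := by rw [hs_def]; exact Real.nat_sqrt_le_real_sqrt
    linarith
  -- `(M^{3/4})² = s³`
  have hB2 : ((M : ℝ) ^ (3 / 4 : ℝ)) ^ 2 = s ^ 3 := by
    rw [hs_def, Real.sqrt_eq_rpow, ← Real.rpow_natCast, ← Real.rpow_natCast,
      ← Real.rpow_mul hM0, ← Real.rpow_mul hM0]
    norm_num
  have e1 : (2 * (M : ℝ) * ((M : ℝ) / 2)) ^ 2 = s ^ 8 := by rw [hx]; ring
  have e2 : 2 * (M : ℝ) * (2 * (M : ℝ)) ^ 2 +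
      2 * (M : ℝ) * (2 * (M : ℝ)) * ((M : ℝ) ^ (3 / 4 : ℝ) / 4) ^ 2 = 8 * s ^ 6 + s ^ 7 / 4 := by
    rw [div_pow, hB2, hx]; ring
  have hfin : s ^ 8 ≤ (j : ℝ) * (8 * s ^ 6 + s ^ 7 / 4) :=
    calc s ^ 8 = (2 * (M : ℝ) * ((M : ℝ) / 2)) ^ 2 := e1.symm
      _ ≤ (j : ℝ) * (2 * (M : ℝ) * (2 * (M : ℝ)) ^ 2 +
          2 * (M : ℝ) * (2 * (M : ℝ)) * ((M : ℝ) ^ (3 / 4 : ℝ) / 4) ^ 2) := hcount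
      _ = (j : ℝ) * (8 * s ^ 6 + s ^ 7 / 4) := by rw [e2]
  exact absurd hfin (not_le.mpr (welchFloor_arith hs64 hjs))

end Summit.Parity.GeneralizedHardyLittlewood.Theorems.CosetDecorrelation.FareyLevelMeanCoupling
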